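import Summits.QuantumFields.BalabanUV.Beta.GAN24.ConvCKOfShapes
import Summits.QuantumFields.BalabanUV.Beta.GAN24.FibreStrip
import Summits.QuantumFields.BalabanUV.Beta.GAN24.FibreArrowBZ
import Summits.QuantumFields.BalabanUV.Beta.GAN24.FibreRate

/-!
# `BalabanUV.Beta.GAN24.KSlotAssembly` — binder row G-an2-4 / (CONV-C), road P1-fibre, row **P1-L12** (= node N18, the END node):
# **THE K-SLOT `CombesThomas.ConvCK 3 Lc` FROM THE TWO LOCATED SHAPES (I3′) ∧ (I2′)** — ONE CALL of `ConvCKOfShapes.convCK_of_shapes` (p201114) per output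

AUTHOR: the swarm's carver `b2b-balaban-gan24-formalise-carver` (gen 4, 2026-08-20; planner seat — filed byte-identical by a PROVER-role COURIER, see the
ledger note).  (I3′) = SHAPE A is row P1-L10's LANDED theorem `FibreStrip.fibreStrip` (leaf-16-g6, p203939); (I2′) = SHAPE B is row P1-L11's LANDED theorem
`FibreRate.realRateK (hLc2 : 2 ≤ Lc) : RealRateK 3 Lc (cFF Lc + cMF Lc + cMF Lc + cmm Lc) ((Lc:ℝ)^2)⁻¹` (leaf-20-g7); both imported BY NAME, nothing restated.
§4 `convCK_holds (hLc : 2 ≤ Lc) : ConvCK 3 Lc` has `2 ≤ Lc` as its ONLY hypothesis (the rate `θ = Lc⁻²` is `< 1` iff `Lc ≥ 2`).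
NOT IN PRINT; OUR PROOF (SKELETON-P1 «P1-fibre» A5 v0.3, cut (M4); TRIGGER-P1 c1–c4).  [folklore] assembly, 0 cite, 0 sorry.

HEADLINE DISCIPLINE (c4, ruling C2): the headline of this file is «K-slot `ConvCK 3 Lc` unconditional (2 of an2's 4 binder families)» — NOT
«G-an2-4 closed»: the S/W stencil binders (`hS hW hSall hWall`), the window `hwin` and the identification (D1) stay hypotheses of the wall
`BalabanStepKernelsRealize`; no «partial discharge of hK/hKall» headline either.  HONEST FRAMING (cell contract, verbatim): «discharging `BetaPertH` makes
Bałaban's UV stability UNCONDITIONAL — a real constructive-QFT result; it is NOT the continuum limit and NOT the Clay problem.»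
HONEST DEPENDENCY (verbatim): «continuum YM on T⁴ ⇐ BetaPertH ∧ nine spine estimates (0/9 proved); BetaPertH ⇐ (D1) ∧ (D4) ∧ CAP+tail; G-an2-4 gates asym,
D1 and NE2/3/4.»  NOT BetaPertH, NOT continuum, NOT Clay.

## Contents
* §1 bookkeeping: the side condition `0 ≤ c` of `convCK_of_shapes` is forced by SHAPE B itself (`j = 0`, `p = 0`); `0 ≤ θ < 1` (`θ = Lc⁻²`, `2 ≤ Lc`) inline;
* §2 the END node as a function of BOTH shapes (`convCK_of_located_shapes`, `convCKWall_of_located_shapes`, `convCResolvent_of_located_shapes`);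
* §3 the END node as a function of SHAPE B alone, SHAPE A := `FibreStrip.fibreStrip` (`convCK_of_realRateK`, `convCKWall_of_realRateK`,
  `convCResolvent_of_realRateK`) — the three currencies: Bloch `ConvCK 3 Lc` (road P1's own), wall `ConvCKWall 3 Lc` (`CombesThomas.convCKWall_of_convCK`),
  and road P3's resolvent target `∃ C δK cK ρ, 0 < δK ∧ 0 ≤ ρ ∧ ρ < 1 ∧ PropagatorWoodburyFibreTarget.ConvCResolvent Lc C δK cK ρ`
  (`ConvCKOfShapes.convCResolvent_of_strip_rate`);
* §4 **the K-slot unconditional for `2 ≤ Lc`**: `convCK_holds`, `convCKWall_holds`, `convCResolvent_holds` — SHAPE B := `FibreRate.realRateK hLc`.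
-/

open Literature.MathematicalPhysics.QuantumFieldTheory
open Literature.MathematicalPhysics.QuantumFieldTheory.Balaban1983to89
open Literature.MathematicalPhysics.QuantumFieldTheory.Balaban1983to89.Beta
open B4Strip (ofRealVec)
open B4ContourShift (BZ StripRegular)
open OneStepResolventKernel (Fib)
open Summit.QuantumFields.BalabanUV.Beta.GAN24.CombesThomas (ConvCK ConvCKWall sfStep smStep convCKWall_of_convCK)
open Summit.QuantumFields.BalabanUV.Beta.GAN24.CombesThomasFibreStep (kFib kFibΔ)
open Summit.QuantumFields.BalabanUV.Beta.PropagatorWoodburyFibreTarget (ConvCResolvent)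
open Summit.QuantumFields.BalabanUV.Beta.GAN24.ConvCKOfShapes (StripRegularK RealRateK convCK_of_shapes
  convCResolvent_of_strip_rate)

namespace Summit.QuantumFields.BalabanUV.Beta.GAN24.KSlotAssembly

/-! ## §1 Bookkeeping: the side condition `0 ≤ c` of `convCK_of_shapes` is forced by SHAPE B itself -/

/-- [folklore] SHAPE B at `j = 0`, `p = 0` forces `0 ≤ c` (a norm is nonnegative; `0 ∈ BZ` is `FibreArrowBZ.zero_mem_BZ`, BY NAME).  The other two side
conditions `0 ≤ θ`, `θ < 1` for `θ = (Lc²)⁻¹`, `2 ≤ Lc` are one-liners kept INSIDE the proofs below (no stand-alone restatement of landed arithmetic). -/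
theorem c_nonneg_of_realRateK {d Lc : ℕ} [NeZero Lc] {c θ : ℝ} (hB : RealRateK d Lc c θ) : 0 ≤ c := by
  have h := hB 0 (fun _ => 0) (fun _ => 0) (Sum.inl 0) (Sum.inl 0) (fun _ => 0) FibreArrowBZ.zero_mem_BZ
  rw [pow_zero, mul_one] at h
  exact (norm_nonneg _).trans h

/-! ## §2 The END node as a function of the two located shapes -/

section EndNode

variable {Lc : ℕ} [NeZero Lc]

/-- [folklore] **K-slot, Bloch form, from (I3′) ∧ (I2′)**: `ConvCK 3 Lc` (`ConvCKOfShapes.convCK_of_shapes` BY NAME; `0 ≤ c` by §1, `0 ≤ θ < 1` inline from `2 ≤ Lc`). -/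
theorem convCK_of_located_shapes (hLc : 2 ≤ Lc)
    (hF9 : ∃ κ, 0 < κ ∧ ∃ Cst, StripRegularK 3 Lc κ Cst)
    {cR : ℝ} (hL11 : RealRateK 3 Lc cR (((Lc : ℝ) ^ 2)⁻¹)) : ConvCK 3 Lc := by
  obtain ⟨κ, hκ, Cst, hA⟩ := hF9
  have hL : (2 : ℝ) ≤ Lc := by exact_mod_cast hLc
  have hθ1 : ((Lc : ℝ) ^ 2)⁻¹ < 1 := inv_lt_one_of_one_lt₀ (by nlinarith)
  exact convCK_of_shapes hκ (c_nonneg_of_realRateK hL11) (by positivity) hθ1 hA hL11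

/-- [folklore] **K-slot, wall form, from (I3′) ∧ (I2′)**: `ConvCKWall 3 Lc` (`CombesThomas.convCKWall_of_convCK` BY NAME: rate `√θ`, decay `δ/2`). -/
theorem convCKWall_of_located_shapes (hLc : 2 ≤ Lc)
    (hF9 : ∃ κ, 0 < κ ∧ ∃ Cst, StripRegularK 3 Lc κ Cst)
    {cR : ℝ} (hL11 : RealRateK 3 Lc cR (((Lc : ℝ) ^ 2)⁻¹)) : ConvCKWall 3 Lc :=
  convCKWall_of_convCK (convCK_of_located_shapes hLc hF9 hL11)

/-- [folklore] **road P3's resolvent target, existential form, from (I3′) ∧ (I2′)**: some `(C, δK, cK, ρ)` with `0 < δK`, `0 ≤ ρ < 1` and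
`ConvCResolvent Lc C δK cK ρ` (`ConvCKOfShapes.convCResolvent_of_strip_rate` BY NAME; the explicit constants are `C = Cst·e^{2κ}`,
`δK = κ/(4Lc)/2`, `cK = √(2(c/(1−θ))·C)`, `ρ = √θ`, `θ = Lc⁻²`). -/
theorem convCResolvent_of_located_shapes (hLc : 2 ≤ Lc)
    (hF9 : ∃ κ, 0 < κ ∧ ∃ Cst, StripRegularK 3 Lc κ Cst)
    {cR : ℝ} (hL11 : RealRateK 3 Lc cR (((Lc : ℝ) ^ 2)⁻¹)) :
    ∃ C δK cK ρ : ℝ, 0 < δK ∧ 0 ≤ ρ ∧ ρ < 1 ∧ ConvCResolvent Lc C δK cK ρ := by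
  obtain ⟨κ, hκ, Cst, hA⟩ := hF9
  have hL : (2 : ℝ) ≤ Lc := by exact_mod_cast hLc
  have hθ0 : (0 : ℝ) ≤ ((Lc : ℝ) ^ 2)⁻¹ := by positivity
  have hθ1 : ((Lc : ℝ) ^ 2)⁻¹ < 1 := inv_lt_one_of_one_lt₀ (by nlinarith)
  refine ⟨_, _, _, _, ?_, Real.sqrt_nonneg _, (Real.sqrt_lt' one_pos).mpr (by simpa using hθ1),
    convCResolvent_of_strip_rate hκ (c_nonneg_of_realRateK hL11) hθ0 hθ1 hA hL11⟩
  have hL0 : (0 : ℝ) < Lc := by linarith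
  positivity

end EndNode

/-! ## §3 The END node as a function of (I2′) alone — (I3′) := `FibreStrip.fibreStrip` (row P1-L10, p203939) BY NAME -/

section OfRealRate

variable {Lc : ℕ} [NeZero Lc]

/-- [folklore] **K-slot, Bloch form, from (I2′)**: `RealRateK 3 Lc cR (Lc²)⁻¹ → ConvCK 3 Lc` for `2 ≤ Lc`; SHAPE A is the landed (I3′) `FibreStrip.fibreStrip`. -/
theorem convCK_of_realRateK (hLc : 2 ≤ Lc) {cR : ℝ} (hL11 : RealRateK 3 Lc cR (((Lc : ℝ) ^ 2)⁻¹)) : ConvCK 3 Lc :=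
  convCK_of_located_shapes hLc FibreStrip.fibreStrip hL11

/-- [folklore] **K-slot, wall form, from (I2′)**: `RealRateK 3 Lc cR (Lc²)⁻¹ → ConvCKWall 3 Lc` for `2 ≤ Lc`. -/
theorem convCKWall_of_realRateK (hLc : 2 ≤ Lc) {cR : ℝ} (hL11 : RealRateK 3 Lc cR (((Lc : ℝ) ^ 2)⁻¹)) : ConvCKWall 3 Lc :=
  convCKWall_of_located_shapes hLc FibreStrip.fibreStrip hL11

/-- [folklore] **road P3's resolvent target from (I2′)**: `RealRateK 3 Lc cR (Lc²)⁻¹ → ∃ C δK cK ρ, 0 < δK ∧ 0 ≤ ρ ∧ ρ < 1 ∧ ConvCResolvent Lc C δK cK ρ`. -/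
theorem convCResolvent_of_realRateK (hLc : 2 ≤ Lc) {cR : ℝ} (hL11 : RealRateK 3 Lc cR (((Lc : ℝ) ^ 2)⁻¹)) :
    ∃ C δK cK ρ : ℝ, 0 < δK ∧ 0 ≤ ρ ∧ ρ < 1 ∧ ConvCResolvent Lc C δK cK ρ :=
  convCResolvent_of_located_shapes hLc FibreStrip.fibreStrip hL11

end OfRealRate

/-! ## §4 THE K-SLOT, UNCONDITIONAL FOR `2 ≤ Lc` — (I3′) := `FibreStrip.fibreStrip` (P1-L10), (I2′) := `FibreRate.realRateK` (P1-L11), both BY NAME -/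

section Holds

variable {Lc : ℕ} [NeZero Lc]

/-- **ROW P1-L12 (END NODE N18) — THE K-SLOT OF BINDER ROW G-an2-4 IN BLOCH FORM: `CombesThomas.ConvCK 3 Lc` holds for every `Lc ≥ 2`.**
ONE CALL of `ConvCKOfShapes.convCK_of_shapes` on (I3′) `FibreStrip.fibreStrip` (κ, Cst) and (I2′) `FibreRate.realRateK hLc` (c = cFF + cMF + cMF + cmm, θ = Lc⁻²).
Headline (c4): «K-slot `ConvCK 3 Lc` unconditional (2 of an2's 4 binder families)» — NOT «G-an2-4 closed» (S/W slots, window, (D1) remain hypotheses of the wall);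
NOT BetaPertH, NOT continuum, NOT Clay. -/
theorem convCK_holds (hLc : 2 ≤ Lc) : ConvCK 3 Lc :=
  convCK_of_realRateK hLc (FibreRate.realRateK hLc)

/-- **THE K-SLOT IN WALL FORM: `CombesThomas.ConvCKWall 3 Lc` for every `Lc ≥ 2`** (`CombesThomas.convCKWall_of_convCK` on `convCK_holds`; rate `√θ = Lc⁻¹`,
decay `δ/2`) — the currency of the wall's `hK`/`hKall` binders in the unit-normalised step kernels; instantiating them in `BalabanStepKernelsRealize` is the
ROW OWNER's read-out (gan24-p1 / an2), not this file. -/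
theorem convCKWall_holds (hLc : 2 ≤ Lc) : ConvCKWall 3 Lc :=
  convCKWall_of_realRateK hLc (FibreRate.realRateK hLc)

/-- **ROAD P3's RESOLVENT TARGET, UNCONDITIONAL FOR `Lc ≥ 2`**: `∃ C δK cK ρ, 0 < δK ∧ 0 ≤ ρ ∧ ρ < 1 ∧ PropagatorWoodburyFibreTarget.ConvCResolvent Lc C δK cK ρ`
(`ConvCKOfShapes.convCResolvent_of_strip_rate` on the two landed shapes). -/
theorem convCResolvent_holds (hLc : 2 ≤ Lc) : ∃ C δK cK ρ : ℝ, 0 < δK ∧ 0 ≤ ρ ∧ ρ < 1 ∧ ConvCResolvent Lc C δK cK ρ :=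
  convCResolvent_of_realRateK hLc (FibreRate.realRateK hLc)

end Holds

end Summit.QuantumFields.BalabanUV.Beta.GAN24.KSlotAssembly
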